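import Mathlib

/-!
# Harris on a complement-closed sublattice of the hypercube (blind cell PercRepro2, p3 g19,
2026-08-27)

The tool for the non-product fibres of the single-`d` class (`proofs/P3-CPNC.md` §16g): if
`L ⊆ Finset ι` is closed under `∪`, `∩` and complement, `G` is monotone and `H` antitone on
`Finset ι`, then `∑_{S ∈ L} (G S − G Sᶜ) · H S ≤ 0` (`sum_sub_compl_mul_nonpos_of_sublattice`).
Proof: Mathlib's FKG inequality (`fkg`, from the four functions theorem) for the indicator
measure of `L` — log-supermodular because `L` is a sublattice — applied to the shifted
non-negative monotone functions `G S − G Sᶜ + c` and `c' − H S`; the mean of `G S − G Sᶜ` over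
`L` vanishes by the bijection `S ↦ Sᶜ` of `L`.  The uniform hypercube (`L = univ`) is the
Harris step of `SideSwitchCompsM9`.  Own work, one seat.
-/

namespace Summit.Ventures.PercRepro2

namespace M9Reduce

open Finset

variable {ι : Type*} [Fintype ι] [DecidableEq ι]

/-- The sum of `G S − G Sᶜ` over a complement-closed family vanishes. -/
lemma sum_sub_compl_eq_zero {L : Finset (Finset ι)} (hL : ∀ ⦃S⦄, S ∈ L → Sᶜ ∈ L)
    (G : Finset ι → ℤ) : ∑ S ∈ L, (G S - G Sᶜ) = 0 := by
  rw [Finset.sum_sub_distrib]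
  have : ∑ S ∈ L, G Sᶜ = ∑ S ∈ L, G S := by
    refine Finset.sum_nbij' (fun S => Sᶜ) (fun S => Sᶜ) (fun S hS => hL hS) (fun S hS => hL hS)
      (fun S _ => compl_compl S) (fun S _ => compl_compl S) (fun S _ => rfl)
  rw [this, sub_self]

/-- **Harris on a complement-closed sublattice.** For `L ⊆ Finset ι` closed under `∪`, `∩` and
complement, `G` monotone and `H` antitone: `∑_{S ∈ L} (G S − G Sᶜ) · H S ≤ 0`. -/
theorem sum_sub_compl_mul_nonpos_of_sublattice {L : Finset (Finset ι)}
    (hsup : ∀ ⦃S T⦄, S ∈ L → T ∈ L → S ∪ T ∈ L) (hinf : ∀ ⦃S T⦄, S ∈ L → T ∈ L → S ∩ T ∈ L)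
    (hcompl : ∀ ⦃S⦄, S ∈ L → Sᶜ ∈ L) {G H : Finset ι → ℤ} (hG : Monotone G) (hH : Antitone H) :
    ∑ S ∈ L, (G S - G Sᶜ) * H S ≤ 0 := by
  classical
  -- the indicator measure of `L`
  let μ : Finset ι → ℤ := fun S => if S ∈ L then 1 else 0
  -- shifts making the two functions non-negative
  let c : ℤ := ∑ S, |G S|
  let c' : ℤ := ∑ S, |H S|
  let F : Finset ι → ℤ := fun S => G S - G Sᶜ + 2 * c
  let K : Finset ι → ℤ := fun S => c' - H S
  have habsG : ∀ S, |G S| ≤ c := fun S =>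
    Finset.single_le_sum (f := fun S => |G S|) (fun S _ => abs_nonneg _) (Finset.mem_univ S)
  have habsH : ∀ S, |H S| ≤ c' := fun S =>
    Finset.single_le_sum (f := fun S => |H S|) (fun S _ => abs_nonneg _) (Finset.mem_univ S)
  have hF₀ : 0 ≤ F := by
    intro S
    have h1 := habsG S; have h2 := habsG Sᶜ
    have := abs_le.1 h1; have := abs_le.1 h2
    simp only [F, Pi.zero_apply]; linarith
  have hK₀ : 0 ≤ K := by
    intro S
    have := abs_le.1 (habsH S)
    simp only [K, Pi.zero_apply]; linarith
  have hμ₀ : 0 ≤ μ := fun S => by simp only [μ, Pi.zero_apply]; split_ifs <;> norm_num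
  have hFmono : Monotone F := by
    intro S T hST
    simp only [F]
    have h1 := hG hST
    have h2 := hG (compl_subset_compl.2 hST)
    linarith
  have hKmono : Monotone K := by
    intro S T hST
    simp only [K]
    have := hH hST
    linarith
  have hμ : ∀ a b, μ a * μ b ≤ μ (a ⊓ b) * μ (a ⊔ b) := by
    intro a b
    simp only [μ]
    by_cases ha : a ∈ L <;> by_cases hb : b ∈ L
    · have h1 : a ⊓ b ∈ L := hinf ha hb
      have h2 : a ⊔ b ∈ L := hsup ha hb
      rw [if_pos ha, if_pos hb, if_pos h1, if_pos h2]
    · rw [if_pos ha, if_neg hb]; simp only [mul_zero]; split_ifs <;> norm_num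
    · rw [if_neg ha]; simp only [zero_mul]; split_ifs <;> norm_num
    · rw [if_neg ha]; simp only [zero_mul]; split_ifs <;> norm_num
  have key := fkg F K μ hμ₀ hF₀ hK₀ hFmono hKmono hμ
  -- rewrite the `μ`-sums as sums over `L`
  have hsum : ∀ f : Finset ι → ℤ, ∑ S, μ S * f S = ∑ S ∈ L, f S := by
    intro f
    simp only [μ, ite_mul, one_mul, zero_mul]
    rw [Finset.sum_ite_mem, Finset.univ_inter]
  have hsum1 : ∑ S, μ S = (L.card : ℤ) := by
    have := hsum (fun _ => 1)
    simp only [mul_one] at this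
    rw [this]; simp
  rw [hsum, hsum, hsum1, hsum] at key
  -- expand `F` and `K`
  have hzero := sum_sub_compl_eq_zero hcompl G
  have eF : ∑ S ∈ L, F S = 2 * c * L.card := by
    simp only [F]
    rw [Finset.sum_add_distrib, hzero, zero_add, Finset.sum_const, nsmul_eq_mul]; ring
  have eK : ∑ S ∈ L, K S = c' * L.card - ∑ S ∈ L, H S := by
    simp only [K]
    rw [Finset.sum_sub_distrib, Finset.sum_const, nsmul_eq_mul]; ring
  have eFK : ∑ S ∈ L, F S * K S =
      -(∑ S ∈ L, (G S - G Sᶜ) * H S) + 2 * c * (c' * L.card - ∑ S ∈ L, H S) := by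
    simp only [F, K]
    have : ∀ S, (G S - G Sᶜ + 2 * c) * (c' - H S) =
        -((G S - G Sᶜ) * H S) + c' * (G S - G Sᶜ) + 2 * c * (c' - H S) := fun S => by ring
    simp_rw [this]
    rw [Finset.sum_add_distrib, Finset.sum_add_distrib, Finset.sum_neg_distrib,
      ← Finset.mul_sum, hzero, mul_zero, add_zero, ← Finset.mul_sum, Finset.sum_sub_distrib,
      Finset.sum_const, nsmul_eq_mul]
    ring
  rw [eF, eK, eFK] at key
  -- `key : 2 c |L| (c' |L| − ΣH) ≤ |L| (−Σ + 2 c (c' |L| − ΣH))`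
  rcases Nat.eq_zero_or_pos L.card with h0 | hpos
  · rw [Finset.card_eq_zero.1 h0]; simp
  · have hposZ : (0 : ℤ) < L.card := by exact_mod_cast hpos
    have hX : (L.card : ℤ) * ∑ S ∈ L, (G S - G Sᶜ) * H S ≤ 0 := by linarith
    exact nonpos_of_mul_nonpos_right hX hposZ

end M9Reduce

end Summit.Ventures.PercRepro2
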